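import Summits.NavierStokesRegularity.NavierStokesRegularity.Theorems.AxisymmetricExtremalityAxisymmetricKatoGlobalReduction
import Literature.Analysis.FluidPDE.AxisymmetricReflection
import Summits.NavierStokesRegularity.NavierStokesRegularity.Theorems.AxisymmetricExtremalityAxisymmetricKatoGlobalNoSwirlStratum
import HarnessLib

/-!
# Strategist s20-g10 (independent census, family `-s`) — typed companion of
# `STRATEGY-CENSUS-s20-g10.md` for crux `AxisymmetricExtremality.AxisymmetricKatoGlobal`
# (stmt-NavierStokesRegularity-15453)

Everything here ELABORATES and is either a `def … : Prop` (a candidate intermediate / piece /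
strengthening, typed so that the census can point at an exact signature) or a PURE-LOGIC theorem
(re-glue / assembly / bookkeeping).  No analysis is claimed; no `sorry`.  Sections follow the census:

* §W  weaker intermediate from the summit side (`NoAxisymMinimalBlowupDatum`, the threshold
      instance `closes` actually consumes; re-glued deciding theorem `summit_of_noAxisymMinimal`);
* §D  decompositions of the crux (no-rate swirl continuity ∧ no-rate criterion; rate-α variant),
      with the assemblies through the landed capstone
      `Registered.AxisymmetricKatoGlobal_of_logSwirlFacts`;
* §T  transfer / re-glue on the full axis group `O(2)` (no-swirl class), typed: `O2KatoGlobal`,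
      `NoSwirlKatoGlobal → O2KatoGlobal` (proved from `IsAxisymmetric.hasNoSwirl_of_reflY_eq`),
      and the O(2) deciding theorem `summit_of_O2` (pure logic) — a ROUTE-LEVEL rider, recorded only;
* §S  the strengthening S⁺ (uniform swirl axis modulus) and S⁺ → S5;
* §N  negation bookkeeping (what a counterexample to the crux is, as data).
-/

open Set MeasureTheory Filter Topology Function Metric
open scoped ENNReal NNReal
open Literature.Analysis.FluidPDE Literature.Analysis.FunctionSpaces

set_option linter.dupNamespace false

namespace Summit.NavierStokesRegularity.NavierStokesRegularity.Cruxes.AxisymmetricKatoGlobal.StrategistS20g10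

open Summit.NavierStokesRegularity.NavierStokesRegularity.Theses.AxisymmetricExtremality
  (MinimalDatumPFold PFoldToAxisymmetric AxisymmetricKatoGlobal)
open Summit.NavierStokesRegularity.NavierStokesRegularity.Theorems.AxisymmetricKatoGlobal

local notation "ℝ³" => EuclideanSpace ℝ (Fin 3)
local notation "Hhalf" =>
  HomSobolev (EuclideanSpace ℝ (Fin 3)) (EuclideanSpace ℂ (Fin 3)) (1 / 2 : ℝ)

/-! ## §W  Weaker intermediate from the summit side -/

/-- **W1** — no axisymmetric `Ḣ^{1/2}`-minimal blow-up datum: the THRESHOLD INSTANCE of the crux,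
and exactly the only thing `closes` consumes of it. -/
def NoAxisymMinimalBlowupDatum : Prop :=
  ∀ ν : ℝ, 0 < ν → ∀ (u₀ : ℝ³ → ℝ³) (g : Hhalf),
    IsMinimalBlowupDatum ν u₀ g → IsAxisymmetric u₀ → False

/-- crux ⇒ W1 (W1 is weaker). -/
theorem noAxisymMinimal_of_crux (h : AxisymmetricKatoGlobal) : NoAxisymMinimalBlowupDatum := by
  intro ν hν u₀ g hmin hax
  obtain ⟨hL3, hrep, hdiv, -, hnot⟩ := hmin
  exact hnot (h ν hν u₀ g hL3 hrep hdiv (fun θ x => hax θ x))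

/-- The route's deciding theorem RE-GLUED on W1 instead of the crux (same pure-logic proof as
`closes`): `MinimalDatumPFold → PFoldToAxisymmetric → W1 → summit`. -/
theorem summit_of_noAxisymMinimal (h₂ : MinimalDatumPFold) (h₄ : PFoldToAxisymmetric)
    (hW : NoAxisymMinimalBlowupDatum) : NavierStokesRegularity := by
  show Literature.NS.NavierStokesExistenceSmoothR3
  intro ν hν u₀ hsm hdiv hdec
  by_contra hno
  obtain ⟨u₁, g, hmin, hax⟩ := h₄ ν hν (h₂ ν hν ⟨u₀, hsm, hdiv, hdec, hno⟩)
  exact hW ν hν u₁ g hmin (fun θ x => hax θ x)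

/-! ## §D  Decompositions of the crux -/

/-- The common frame of the lead's stub `stub_swirlAxisModulus` (S5): a smooth axisymmetric Kato
solution on `[0,T)` from a represented datum, and a property `P` of it from time `t₀` on. -/
def ForKatoAxisym (P : ℝ → ℝ → (ℝ → ℝ³ → ℝ³) → ℝ → Prop) : Prop :=
  ∀ ν : ℝ, 0 < ν → ∀ T : ℝ, 0 < T → ∀ (u₀ : ℝ³ → ℝ³) (g : Hhalf) (u : ℝ → ℝ³ → ℝ³),
    g.Represents (Literature.Analysis.FunctionSpaces.EuclideanSpace.complexify ∘ u₀) →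
    IsKatoSolutionOn T ν u₀ u → ContDiffOn ℝ (⊤ : ℕ∞) (uncurry u) (Ioo 0 T ×ˢ univ) →
    (∀ t ∈ Ioo 0 T, IsAxisymmetric (u t)) →
    ∀ t₀ ∈ Ioo 0 T, P ν T u t₀

/-- log^α axis modulus of the swirl on `[t₀,T)` (α = 3 is S5's conclusion). -/
def LogModulus (α : ℝ) (T : ℝ) (u : ℝ → ℝ³ → ℝ³) (t₀ : ℝ) : Prop :=
  ∃ C δ₀ : ℝ, 0 < δ₀ ∧ δ₀ < 1 ∧ ∀ t ∈ Ico t₀ T, ∀ x : ℝ³, cylRadius x ≤ δ₀ →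
    |swirl (u t) x| ≤ C / |Real.log (cylRadius x)| ^ α

/-- no-rate continuity of the swirl at the axis, uniformly on `[t₀,T)`. -/
def AxisContinuity (T : ℝ) (u : ℝ → ℝ³ → ℝ³) (t₀ : ℝ) : Prop :=
  ∀ ε : ℝ, 0 < ε → ∃ δ : ℝ, 0 < δ ∧ ∀ t ∈ Ico t₀ T, ∀ x : ℝ³, cylRadius x ≤ δ →
    |swirl (u t) x| ≤ ε

/-- the log³ axis modulus exactly as typed in the lead's stub (natural-number exponent). -/
def Log3Modulus (T : ℝ) (u : ℝ → ℝ³ → ℝ³) (t₀ : ℝ) : Prop :=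
  ∃ C δ₀ : ℝ, 0 < δ₀ ∧ δ₀ < 1 ∧ ∀ t ∈ Ico t₀ T, ∀ x : ℝ³, cylRadius x ≤ δ₀ →
    |swirl (u t) x| ≤ C / |Real.log (cylRadius x)| ^ 3

theorem log3Modulus_iff_logModulus (T : ℝ) (u : ℝ → ℝ³ → ℝ³) (t₀ : ℝ) :
    Log3Modulus T u t₀ ↔ LogModulus 3 T u t₀ := by
  unfold Log3Modulus LogModulus
  have key : ∀ y : ℝ, y ^ (3 : ℝ) = y ^ (3 : ℕ) := fun y => by
    rw [show (3 : ℝ) = ((3 : ℕ) : ℝ) by norm_num, Real.rpow_natCast]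
  simp only [key]

/-- **S5** = the lead's open stub `stub_swirlAxisModulus`, in the frame (verbatim conclusion). -/
def S5 : Prop := ForKatoAxisym fun _ T u t₀ => Log3Modulus T u t₀

/-- **D1** — no-rate swirl continuity at the axis up to the final time (OPEN). -/
def SwirlAxisContinuity : Prop := ForKatoAxisym fun _ T u t₀ => AxisContinuity T u t₀

/-- **D2** — the no-rate criterion: any axis modulus of the swirl upgrades to the log³ modulus
(equivalently, by Seregin 2022 / Wei 2016, to regularity).  OPEN; printed ceiling |ln r|^{-3/2}. -/
def NoRateSwirlCriterion : Prop :=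
  ForKatoAxisym fun _ T u t₀ => AxisContinuity T u t₀ → Log3Modulus T u t₀

/-- **D1α** — a log^α axis modulus for SOME α > 0 (OPEN for every α > 0). -/
def SwirlAxisSomeLogModulus : Prop := ForKatoAxisym fun _ T u t₀ => ∃ α : ℝ, 0 < α ∧ LogModulus α T u t₀

/-- **D2α** — bootstrap: every positive log-power modulus upgrades to log³ (OPEN below α = 3/2;
KNOWN in the classical class at α = 3/2, Wei 2016, tree `Wei2016_logModulus_regularity_holds`). -/
def LogModulusBootstrap : Prop :=
  ForKatoAxisym fun _ T u t₀ => ∀ α : ℝ, 0 < α → LogModulus α T u t₀ → Log3Modulus T u t₀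

/-- S5 is literally the statement the landed capstone consumes. -/
theorem crux_of_S5 (hfact : seregin2022_logSwirl_regularAtOrigin) (h5 : S5) :
    AxisymmetricKatoGlobal :=
  Registered.AxisymmetricKatoGlobal_of_logSwirlFacts hfact h5

/-- assembly of the no-rate split: D1 → D2 → S5 (pure logic). -/
theorem S5_of_D1_D2 (h1 : SwirlAxisContinuity) (h2 : NoRateSwirlCriterion) : S5 :=
  fun ν hν T hT u₀ g u hrep hK hC hax t₀ ht₀ =>
    h2 ν hν T hT u₀ g u hrep hK hC hax t₀ ht₀ (h1 ν hν T hT u₀ g u hrep hK hC hax t₀ ht₀)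

/-- … hence D1 → D2 → crux, given the Seregin 2022 named fact. -/
theorem crux_of_D1_D2 (hfact : seregin2022_logSwirl_regularAtOrigin) (h1 : SwirlAxisContinuity)
    (h2 : NoRateSwirlCriterion) : AxisymmetricKatoGlobal :=
  crux_of_S5 hfact (S5_of_D1_D2 h1 h2)

/-- assembly of the rate-α split: D1α → D2α → S5 (pure logic). -/
theorem S5_of_D1α_D2α (h1 : SwirlAxisSomeLogModulus) (h2 : LogModulusBootstrap) : S5 :=
  fun ν hν T hT u₀ g u hrep hK hC hax t₀ ht₀ => by
    obtain ⟨α, hα, hmod⟩ := h1 ν hν T hT u₀ g u hrep hK hC hax t₀ ht₀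
    exact h2 ν hν T hT u₀ g u hrep hK hC hax t₀ ht₀ α hα hmod

/-- a log^α modulus (α > 0) gives no-rate continuity; hence D1α ⇒ D1 and D2 ⇒ D2α (the
no-rate criterion is the STRONGER criterion, the some-rate continuity the STRONGER continuity):
the two splits trade difficulty between the halves and meet at the printed ceiling α = 3/2. -/
theorem axisContinuity_of_logModulus {α T t₀ : ℝ} {u : ℝ → ℝ³ → ℝ³} (hα : 0 < α)
    (h : LogModulus α T u t₀) : AxisContinuity T u t₀ := by
  intro ε hε
  obtain ⟨C, δ₀, hδ₀, hδ₁, hb⟩ := h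
  have hlim : Tendsto (fun r : ℝ => C / |Real.log r| ^ α) (𝓝[>] 0) (𝓝 0) := by
    have h1 : Tendsto (fun r : ℝ => |Real.log r| ^ α) (𝓝[>] 0) atTop :=
      (tendsto_rpow_atTop hα).comp (tendsto_abs_atBot_atTop.comp Real.tendsto_log_nhdsGT_zero)
    exact tendsto_const_nhds.div_atTop h1
  have hev : ∀ᶠ r in 𝓝[>] (0 : ℝ), C / |Real.log r| ^ α ≤ ε := hlim.eventually (ge_mem_nhds hε)
  obtain ⟨b, hb0, hsub⟩ := mem_nhdsGT_iff_exists_Ioo_subset.mp hev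
  refine ⟨min δ₀ (b / 2), lt_min hδ₀ (half_pos (mem_Ioi.mp hb0)), fun t ht x hx => ?_⟩
  have hxδ₀ : cylRadius x ≤ δ₀ := hx.trans (min_le_left _ _)
  refine (hb t ht x hxδ₀).trans ?_
  rcases (cylRadius_nonneg x).eq_or_lt with h0 | hpos
  · rw [← h0, Real.log_zero, abs_zero, Real.zero_rpow hα.ne', div_zero]
    exact hε.le
  · have hxb : cylRadius x < b :=
      lt_of_le_of_lt (hx.trans (min_le_right _ _)) (by linarith [mem_Ioi.mp hb0])
    exact hsub ⟨hpos, hxb⟩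

theorem swirlAxisContinuity_of_someLogModulus (h : SwirlAxisSomeLogModulus) : SwirlAxisContinuity :=
  fun ν hν T hT u₀ g u hrep hK hC hax t₀ ht₀ => by
    obtain ⟨α, hα, hmod⟩ := h ν hν T hT u₀ g u hrep hK hC hax t₀ ht₀
    exact axisContinuity_of_logModulus hα hmod

theorem logModulusBootstrap_of_noRate (h : NoRateSwirlCriterion) : LogModulusBootstrap :=
  fun ν hν T hT u₀ g u hrep hK hC hax t₀ ht₀ _α hα hmod =>
    h ν hν T hT u₀ g u hrep hK hC hax t₀ ht₀ (axisContinuity_of_logModulus hα hmod)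

/-! ## §T  Transfer / re-glue on the full axis group O(2) (route-level rider; recorded only) -/

/-- `O(2)`-equivariance about the `x₂`-axis: axisymmetric AND equivariant under the meridian
reflection `σ = reflY`.  By `IsAxisymmetric.hasNoSwirl_iff_reflY` (tree, proved) this is exactly
"axisymmetric without swirl". -/
def IsO2Symmetric (u : ℝ³ → ℝ³) : Prop :=
  IsAxisymmetric u ∧ ∀ x, u (reflY x) = reflY (u x)

theorem isO2Symmetric_iff_noSwirl (u : ℝ³ → ℝ³) :
    IsO2Symmetric u ↔ IsAxisymmetric u ∧ HasNoSwirl u :=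
  ⟨fun h => ⟨h.1, h.1.hasNoSwirl_of_reflY_eq h.2⟩,
    fun h => ⟨h.1, fun x => h.1.reflY_eq_of_hasNoSwirl h.2 x⟩⟩

/-- **T-NoSwirl** — global Kato solutions for axisymmetric SWIRL-FREE critical data (the
Ladyzhenskaya / Ukhovskii–Yudovich theorem in the KATO class: in the tree only in the classical
finite-energy class, `axisymmetric_no_swirl_global_regularity_holds`; in print for `H^{1/2}`
(Abidi 2008), for `ω_θ ∈ L¹(Ω)` (Gallay–Šverák 2015, Thm 1.1) and weighted-`L²` infinite energy
(Fernández-Dalgo–Gallay 2021); the `Ḣ^{1/2}`/`L³` statement itself is a support-size item). -/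
def NoSwirlKatoGlobal : Prop :=
  ∀ ν : ℝ, 0 < ν → ∀ (u₀ : ℝ³ → ℝ³) (g : Hhalf), MemLp u₀ 3 volume →
    g.Represents (Literature.Analysis.FunctionSpaces.EuclideanSpace.complexify ∘ u₀) →
    Literature.Analysis.FluidPDE.IsWeaklyDivFree u₀ → IsAxisymmetric u₀ → HasNoSwirl u₀ →
    HasGlobalKatoSolution ν u₀

/-- **T-O2** — the crux with `SO(2)` replaced by `O(2)`. -/
def O2KatoGlobal : Prop :=
  ∀ ν : ℝ, 0 < ν → ∀ (u₀ : ℝ³ → ℝ³) (g : Hhalf), MemLp u₀ 3 volume →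
    g.Represents (Literature.Analysis.FunctionSpaces.EuclideanSpace.complexify ∘ u₀) →
    Literature.Analysis.FluidPDE.IsWeaklyDivFree u₀ → IsO2Symmetric u₀ → HasGlobalKatoSolution ν u₀

theorem o2KatoGlobal_of_noSwirl (h : NoSwirlKatoGlobal) : O2KatoGlobal :=
  fun ν hν u₀ g hL3 hrep hdiv hO2 =>
    h ν hν u₀ g hL3 hrep hdiv hO2.1 (hO2.1.hasNoSwirl_of_reflY_eq hO2.2)

/-- the crux trivially gives the O(2) statement (O(2)-data are axisymmetric). -/
theorem o2KatoGlobal_of_crux (h : AxisymmetricKatoGlobal) : O2KatoGlobal :=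
  fun ν hν u₀ g hL3 hrep hdiv hO2 => h ν hν u₀ g hL3 hrep hdiv (fun θ x => hO2.1 θ x)

/-- rotation by `2π / 2^k` about the axis, written out as in `MinimalDatumPFold`. -/
def IsDyadicFoldSymmetric (k : ℕ) (u : ℝ³ → ℝ³) : Prop :=
  ∀ x : ℝ³, u (WithLp.toLp 2 ![Real.cos (2 * Real.pi / (2 ^ k : ℕ)) * x 0 -
      Real.sin (2 * Real.pi / (2 ^ k : ℕ)) * x 1, Real.sin (2 * Real.pi / (2 ^ k : ℕ)) * x 0 +
      Real.cos (2 * Real.pi / (2 ^ k : ℕ)) * x 1, x 2]) =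
    WithLp.toLp 2 ![Real.cos (2 * Real.pi / (2 ^ k : ℕ)) * u x 0 -
      Real.sin (2 * Real.pi / (2 ^ k : ℕ)) * u x 1, Real.sin (2 * Real.pi / (2 ^ k : ℕ)) * u x 0 +
      Real.cos (2 * Real.pi / (2 ^ k : ℕ)) * u x 1, u x 2]

/-- equivariance under the dihedral 2-group `D_{2^k} = ⟨R_{2π/2^k}, σ⟩` (order `2^{k+1}`). -/
def IsDihedralDyadicSymmetric (k : ℕ) (u : ℝ³ → ℝ³) : Prop :=
  IsDyadicFoldSymmetric k u ∧ ∀ x, u (reflY x) = reflY (u x)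

/-- **T-MinDih** — the O(2)-rider's extremality crux: a Clay blow-up forces, for unboundedly many
`k`, an `Ḣ^{1/2}`-minimal blow-up datum equivariant under the 2-GROUP `D_{2^k}` (Smith theory for
`p`-groups needs only `F₂`-acyclicity of the minimal-data moduli; same shape as `MinimalDatumPFold`). -/
def MinimalDatumDihedral : Prop :=
  ∀ ν : ℝ, 0 < ν → (∃ v₀ : ℝ³ → ℝ³, ContDiff ℝ (⊤ : ℕ∞) v₀ ∧
      Literature.Analysis.FluidPDE.NSWave0.IsDivFree v₀ ∧ HasRapidSpatialDecay v₀ ∧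
      ¬ ∃ (u : ℝ → ℝ³ → ℝ³) (p : ℝ → ℝ³ → ℝ), IsSmoothOnHalfSpace u ∧ IsSmoothOnHalfSpace p ∧
        IsNavierStokesSolution ν 0 v₀ u p ∧ HasBoundedEnergy u) →
    ∀ N : ℕ, ∃ k : ℕ, N ≤ k ∧ ∃ (u₀ : ℝ³ → ℝ³) (g : Hhalf),
      IsMinimalBlowupDatum ν u₀ g ∧ IsDihedralDyadicSymmetric k u₀

/-- **T-DihToO2** — compactness upgrade, dihedral version of the PROVED `PFoldToAxisymmetric`:
dihedral-`D_{2^k}` minimal data for unboundedly many `k` ⇒ an `O(2)`-symmetric minimal datum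
(closure of `⋃ D_{2^k}` is `O(2)`; reflection equivariance is a closed condition in `Ḣ^{1/2}`). -/
def DihedralToO2 : Prop :=
  ∀ ν : ℝ, 0 < ν → (∀ N : ℕ, ∃ k : ℕ, N ≤ k ∧ ∃ (u₀ : ℝ³ → ℝ³) (g : Hhalf),
      IsMinimalBlowupDatum ν u₀ g ∧ IsDihedralDyadicSymmetric k u₀) →
    ∃ (u₀ : ℝ³ → ℝ³) (g : Hhalf), IsMinimalBlowupDatum ν u₀ g ∧ IsO2Symmetric u₀

/-- The O(2) deciding theorem (pure logic): the rider REMOVES this crux from the route, replacing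
it by `NoSwirlKatoGlobal` (known mathematics, support-size), at the price of the extremality crux
`MinimalDatumDihedral` (≡ summit given the rest, exactly as `MinimalDatumPFold` is now). -/
theorem summit_of_O2 (h₂ : MinimalDatumDihedral) (h₄ : DihedralToO2) (h₃ : NoSwirlKatoGlobal) :
    NavierStokesRegularity := by
  show Literature.NS.NavierStokesExistenceSmoothR3
  intro ν hν u₀ hsm hdiv hdec
  by_contra hno
  obtain ⟨u₁, g, hmin, hO2⟩ := h₄ ν hν (h₂ ν hν ⟨u₀, hsm, hdiv, hdec, hno⟩)
  obtain ⟨hL3, hrep, hdiv₁, -, hnot⟩ := hmin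
  exact hnot (o2KatoGlobal_of_noSwirl h₃ ν hν u₁ g hL3 hrep hdiv₁ hO2)

/-- POSTSCRIPT ERRATUM to census §3 T-e (learned only on reading the earlier censuses / idea
`dihedral-smith-bypass` AFTER the verdict was written): the Kato-class no-swirl theorem is LANDED in
the tree — `NoSwirlStratum.axisymmetricKatoGlobal_noSwirl_stratum` (even for `L³` data without an
`Ḣ^{1/2}` representative).  So `NoSwirlKatoGlobal` is a theorem, not a support item: -/
theorem noSwirlKatoGlobal_holds : NoSwirlKatoGlobal :=
  fun ν hν u₀ _g hL3 _hrep hdiv hax hsw =>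
    NoSwirlStratum.axisymmetricKatoGlobal_noSwirl_stratum ν hν u₀ hL3 hdiv (fun θ x => hax θ x) hsw

/-- … and the O(2)/dihedral re-glue decides the summit from the two extremality items ALONE
(same shape as s16-g3's `summit_of_dihedral`; re-derived here independently up to the erratum). -/
theorem summit_of_dihedral (h₂ : MinimalDatumDihedral) (h₄ : DihedralToO2) : NavierStokesRegularity :=
  summit_of_O2 h₂ h₄ noSwirlKatoGlobal_holds

/-! ## §S  Strengthening S⁺ -/

/-- **S⁺** — UNIFORM swirl axis modulus: the log³ constant and radius depend only on
`(ν, ‖g‖, t₀, T)`, not on the solution (a priori estimate form; what a compactness/rigidity proof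
would give).  S⁺ ⇒ S5 trivially; the added uniformity exposes no new tool (see census §Strengthen). -/
def UniformSwirlAxisModulus : Prop :=
  ∃ Cst δst : ℝ → ℝ≥0∞ → ℝ → ℝ → ℝ,
    ∀ ν : ℝ, 0 < ν → ∀ T : ℝ, 0 < T → ∀ (u₀ : ℝ³ → ℝ³) (g : Hhalf) (u : ℝ → ℝ³ → ℝ³),
      g.Represents (Literature.Analysis.FunctionSpaces.EuclideanSpace.complexify ∘ u₀) →
      IsKatoSolutionOn T ν u₀ u → ContDiffOn ℝ (⊤ : ℕ∞) (uncurry u) (Ioo 0 T ×ˢ univ) →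
      (∀ t ∈ Ioo 0 T, IsAxisymmetric (u t)) →
      ∀ t₀ ∈ Ioo 0 T, 0 < δst ν ‖g‖ₑ t₀ T ∧ δst ν ‖g‖ₑ t₀ T < 1 ∧
        ∀ t ∈ Ico t₀ T, ∀ x : ℝ³, cylRadius x ≤ δst ν ‖g‖ₑ t₀ T →
          |swirl (u t) x| ≤ Cst ν ‖g‖ₑ t₀ T / |Real.log (cylRadius x)| ^ 3

theorem S5_of_uniform (h : UniformSwirlAxisModulus) : S5 := by
  obtain ⟨Cst, δst, hall⟩ := h
  intro ν hν T hT u₀ g u hrep hK hC hax t₀ ht₀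
  obtain ⟨hδ0, hδ1, hb⟩ := hall ν hν T hT u₀ g u hrep hK hC hax t₀ ht₀
  exact ⟨Cst ν ‖g‖ₑ t₀ T, δst ν ‖g‖ₑ t₀ T, hδ0, hδ1, hb⟩

/-! ## §N  Negation bookkeeping -/

/-- What a counterexample to the crux IS, as data: a viscosity, an axisymmetric weakly
divergence-free `L³` datum represented in `Ḣ^{1/2}`, with NO global Kato solution.  (By KNSS 2009 /
Seregin 2020 — the registered stubs 2–3 — its singularity is Type II at an axis point; by the
landed `axisymmetricKatoGlobal_false_without_divFree` the divergence constraint is load-bearing.) -/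
theorem counterexample_shape_of_not_crux (h : ¬ AxisymmetricKatoGlobal) :
    ∃ ν : ℝ, 0 < ν ∧ ∃ (u₀ : ℝ³ → ℝ³) (g : Hhalf), MemLp u₀ 3 volume ∧
      g.Represents (Literature.Analysis.FunctionSpaces.EuclideanSpace.complexify ∘ u₀) ∧
      Literature.Analysis.FluidPDE.IsWeaklyDivFree u₀ ∧ IsAxisymmetric u₀ ∧
      ¬ HasGlobalKatoSolution ν u₀ := by
  by_contra hne
  apply h
  intro ν hν u₀ g hL3 hrep hdiv hax
  by_contra hno
  exact hne ⟨ν, hν, u₀, g, hL3, hrep, hdiv, fun θ x => hax θ x, hno⟩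

/-- … and conversely W1 says such a counterexample is never `Ḣ^{1/2}`-MINIMAL among blow-up data;
the gap between "no minimal axisymmetric counterexample" and "no axisymmetric counterexample" is
exactly the non-propagation of minimality (census §W). -/
theorem crux_iff_no_counterexample :
    AxisymmetricKatoGlobal ↔ ¬ ∃ ν : ℝ, 0 < ν ∧ ∃ (u₀ : ℝ³ → ℝ³) (g : Hhalf), MemLp u₀ 3 volume ∧
      g.Represents (Literature.Analysis.FunctionSpaces.EuclideanSpace.complexify ∘ u₀) ∧
      Literature.Analysis.FluidPDE.IsWeaklyDivFree u₀ ∧ IsAxisymmetric u₀ ∧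
      ¬ HasGlobalKatoSolution ν u₀ := by
  constructor
  · rintro h ⟨ν, hν, u₀, g, hL3, hrep, hdiv, hax, hno⟩
    exact hno (h ν hν u₀ g hL3 hrep hdiv (fun θ x => hax θ x))
  · intro h
    by_contra hc
    exact h (counterexample_shape_of_not_crux hc)

end Summit.NavierStokesRegularity.NavierStokesRegularity.Cruxes.AxisymmetricKatoGlobal.StrategistS20g10
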